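import Summits.QuantumFields.BalabanUV.Beta.FP.ResponseVertexLipschitz

/-!
# `BalabanUV.Beta.FP.ResponseVertexLimit` — road «FP» for binder row D1, `RESIDUAL-FP.md` ROW #14 ∕ R-FP-41 (b) (owner, gen 10): THE SECOND-RESPONSE PIECE
# `(μ y ν y′) ↦ dM (K2 ν y′) N S M μ y` IS LIPSCHITZ IN `(K2, S, M)` (one-centre at `(N•y′, N•y′)`), hence — with `K2 := K2OfK K N S M` and FILE 1's
# `vertexFamily_K2OfK_sub` — the constructed limit of the fourth summand of `W2OfK` along (CONV-C)-type rates IS the second-response piece of the limits.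
# With `BiVertexLimit` (summand 1) and `MixVertexLimit` (summands 2, 3) ALL FOUR summands of the literal's second-order slot are now identified in the limit.

HONEST DEPENDENCY (page 1, mandatory): continuum YM on T⁴ ⇐ BetaPertH ∧ nine spine estimates (0/9 proved); BetaPertH ⇐ (D1) ∧ (D4) ∧ CAP+tail;
G-an2-4 gates asym, D1 and NE2/3/4.  HONEST FRAMING (cell contract, verbatim): «discharging `BetaPertH` makes Bałaban's UV stability UNCONDITIONAL —
a real constructive-QFT result; it is NOT the continuum limit and NOT the Clay problem.»  THIS MODULE is [folklore] kernel bookkeeping (no `def`, no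
`def … : Prop`, nothing cited, 0 sorry); every rate ∕ row is a HYPOTHESIS SHAPE with free constants, asserted for no object of Bałaban's.  0∕4 row-D1 binders;
NOT X1, NOT (G8), NOT row #14 for the literal, NOT (ASYMP), NOT D1, NOT BetaPertH, NOT continuum, NOT Clay.  «not in print; our bookkeeping».

ABSOLUTE RULE (cell charter, verbatim): «No internally-minted statement may enter as a cited fact. Every hypothesis is either kernel-proved in this package or a
verbatim quotation of a PUBLISHED theorem with page reference. The manuscript(s) under audit are NOT citable for their own disputed steps — they are the thing
under adjudication; programme-internal (2001/route/tribunal) claims are never citable.»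

CONTENT.
* §1 [folklore] vertices through a kernel BI-LOCALISED at `(q, q)` (the derivative-of-the-inverse slot), difference twins of Literature
  `SecondOrderResponse.biLoc_vertexOfK_of_biLoc` ∕ `biLoc_vertexOfM_of_biLoc`: **`biLoc_vertexOfK_of_biLoc_sub`**, **`biLoc_vertexOfM_of_biLoc_sub`**.
* §2 [folklore] **`biLoc_resp_sub`** — for vertex families `K2, K2′` (the slot of `K2OfK`), stencils and multiplier tables with their differences:
  `BiLoc (dM (K2 ν y′) N S M μ y − dM (K2′ ν y′) N S′ M′ μ y) (N•y′) (N•y′) ((d+1)·((ε₂·Cs + C₂′·εS)·Zl(m/2)) + (d+1)·((ε₂·CM + C₂′·εM)·Zl(m/2))) (m/2)`.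
* §3 [folklore] at `K2 := K2OfK K N S M`: **`vertexFamily_K2OfK_rate`** (FILE 1's Lipschitz letter in rate form), **`biLoc_resp_K2OfK_rate`**,
  **`limTabOf_resp_eq`** (`limTabOf (j ↦ (μ y ν y′ ↦ dM (K2OfK (K j) N (S j) (M j) ν y′) N (S j) (M j) μ y)) = (μ y ν y′ ↦ dM (K2OfK K∞ N S∞ M∞ ν y′) N S∞ M∞ μ y)`
  under uniform rows + geometric rates of `(K_j, S_j, M_j)`, `0 ≤ θ < 1`), `tendsto_resp`.
Provenance: road FP OWNER b2b-balaban-beta-d1-p3 gen 10 (prover-b2b-balaban-beta-d1-p3-g10-0), 2026-08-21, row #14 ∕ R-FP-41 (b), file 2 of 2.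
-/

noncomputable section

namespace Summit.QuantumFields.BalabanUV.Beta.FP.ResponseVertexLimit

open Filter Topology
open Literature.MathematicalPhysics.QuantumFieldTheory
open Literature.MathematicalPhysics.QuantumFieldTheory.Balaban1983to89
open Literature.MathematicalPhysics.QuantumFieldTheory.Balaban1983to89.Beta
open B12Sec2to5 (l1 l1_nonneg)
open ExpKernelCalculus (MKer Decays BiLoc VertexFamily Zl Zl_nonneg)
open OneStepResolventKernel (Fib LocStencil wsum biLoc_finset_sum biLoc_mono)
open OneStepKernelFamily (colH vertexOfK)
open InterLevelTransport (cwsum)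
open SecondOrderResponse (colM vertexOfM dM K2OfK abs_colH_le_of_biLoc abs_colM_le_of_biLoc vertexFamily_K2OfK cK2)
open KernelWard (biLoc_add)
open HessKerRate (biLoc_wsum_sub_wsum colH_sub)
open HessKerDressedLimit (limMKerOf limTabOf limTabOf_apply limMKerOf_eq_of_biLoc_rate tendsto_of_biLoc_rate)
open Summit.QuantumFields.BalabanUV.Beta.FP.ResponseVertexLipschitz (biLoc_cwsum_sub_self vertexFamily_K2OfK_sub)

variable {d : ℕ} {N : ℕ} [NeZero N]

/-! ## §1 Vertices through a kernel bi-localised at `(q, q)` are Lipschitz in (kernel, tables) -/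

section Through

omit [NeZero N] in
/-- [folklore] The field column of a kernel bi-localised at `(q, q)` decays from `q` (the factor in `|N•y − q|` dropped). -/
theorem abs_colH_le_of_biLoc' {K : MKer (d + 1) (Fib d)} {q : Fin (d + 1) → ℤ} {C m : ℝ} (h : BiLoc K q q C m) (hm : 0 ≤ m)
    (μ : Fin (d + 1)) (y : Fin (d + 1) → ℤ) (κ : Fin (d + 1)) (u : Fin (d + 1) → ℤ) : |colH K N μ y κ u| ≤ C * Real.exp (-m * l1 (u - q)) := by
  have hC : 0 ≤ C := h.nonneg (Sum.inl 0)
  refine (abs_colH_le_of_biLoc (N := N) h μ y κ u).trans ?_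
  have he : Real.exp (-m * l1 ((N : ℤ) • y - q)) ≤ 1 := by
    rw [Real.exp_le_one_iff]; nlinarith [l1_nonneg ((N : ℤ) • y - q)]
  calc C * Real.exp (-m * l1 ((N : ℤ) • y - q)) * Real.exp (-m * l1 (u - q))
      ≤ C * 1 * Real.exp (-m * l1 (u - q)) :=
        mul_le_mul_of_nonneg_right (mul_le_mul_of_nonneg_left he hC) (Real.exp_pos _).le
    _ = C * Real.exp (-m * l1 (u - q)) := by ring

omit [NeZero N] in
/-- [folklore] The multiplier column of a kernel bi-localised at `(q, q)` decays from `q` as a function of the coarse point (factor in `|N•y − q|` dropped). -/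
theorem abs_colM_le_of_biLoc' {K : MKer (d + 1) (Fib d)} {q : Fin (d + 1) → ℤ} {C m : ℝ} (h : BiLoc K q q C m) (hm : 0 ≤ m)
    (μ : Fin (d + 1)) (y : Fin (d + 1) → ℤ) (ρ : Fin (d + 1)) (w : Fin (d + 1) → ℤ) :
    |colM K N μ y ρ w| ≤ C * Real.exp (-m * l1 ((N : ℤ) • w - q)) := by
  have hC : 0 ≤ C := h.nonneg (Sum.inl 0)
  refine (abs_colM_le_of_biLoc (N := N) h μ y ρ w).trans ?_
  have he : Real.exp (-m * l1 ((N : ℤ) • y - q)) ≤ 1 := by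
    rw [Real.exp_le_one_iff]; nlinarith [l1_nonneg ((N : ℤ) • y - q)]
  calc C * Real.exp (-m * l1 ((N : ℤ) • y - q)) * Real.exp (-m * l1 ((N : ℤ) • w - q))
      ≤ C * 1 * Real.exp (-m * l1 ((N : ℤ) • w - q)) :=
        mul_le_mul_of_nonneg_right (mul_le_mul_of_nonneg_left he hC) (Real.exp_pos _).le
    _ = C * Real.exp (-m * l1 ((N : ℤ) • w - q)) := by ring

omit [NeZero N] in
/-- [folklore] **THE FIELD-COLUMN VERTEX THROUGH A BI-LOCALISED KERNEL IS LIPSCHITZ IN (kernel, stencils)**: `K₂, K₂′` bi-localised at `(q, q)` (rate `m`, constants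
`C₂, C₂′`, difference `ε₂`), local stencils `S, S′` (rate `m`, constants `Cs, Cs′`, difference `εS`) ⟹
`BiLoc (vertexOfK K₂ N S μ y − vertexOfK K₂′ N S′ μ y) q q ((d+1)·((ε₂·Cs + C₂′·εS)·Zl(m/2))) (m/2)`. -/
theorem biLoc_vertexOfK_of_biLoc_sub {K₂ K₂' : MKer (d + 1) (Fib d)} {q : Fin (d + 1) → ℤ} {C₂ C₂' ε₂ m : ℝ}
    (hK : BiLoc K₂ q q C₂ m) (hK' : BiLoc K₂' q q C₂' m) (hKK : BiLoc (K₂ - K₂') q q ε₂ m) (hm : 0 < m)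
    {S S' : Fin (d + 1) → (Fin (d + 1) → ℤ) → MKer (d + 1) (Fib d)} {Cs Cs' εS : ℝ}
    (hS : LocStencil S Cs m) (hS' : LocStencil S' Cs' m) (hSS : LocStencil (S - S') εS m) (μ : Fin (d + 1)) (y : Fin (d + 1) → ℤ) :
    BiLoc (vertexOfK K₂ N S μ y - vertexOfK K₂' N S' μ y) q q ((d + 1 : ℕ) * ((ε₂ * Cs + C₂' * εS) * Zl (d + 1) (m / 2))) (m / 2) := by
  have hC₂ : 0 ≤ C₂ := hK.nonneg (Sum.inl 0)
  have hC₂' : 0 ≤ C₂' := hK'.nonneg (Sum.inl 0)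
  have hε₂ : 0 ≤ ε₂ := hKK.nonneg (Sum.inl 0)
  have hterm : ∀ κ : Fin (d + 1), BiLoc (wsum (colH K₂ N μ y κ) (S κ) - wsum (colH K₂' N μ y κ) (S' κ)) q q
      ((ε₂ * Cs + C₂' * εS) * Zl (d + 1) (m / 2)) (m / 2) := fun κ =>
    biLoc_wsum_sub_wsum (fun u => abs_colH_le_of_biLoc' (N := N) hK hm.le μ y κ u) (fun u => abs_colH_le_of_biLoc' (N := N) hK' hm.le μ y κ u)
      (fun u => by rw [← colH_sub]; exact abs_colH_le_of_biLoc' (N := N) hKK hm.le μ y κ u)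
      (fun u => hS κ u) (fun u => hS' κ u) (fun u => by simpa only [Pi.sub_apply] using hSS κ u) hm hC₂ hC₂' hε₂
  have hsum := biLoc_finset_sum (Finset.univ : Finset (Fin (d + 1))) (fun κ _ => hterm κ)
  simp only [Finset.sum_const, Finset.card_univ, Fintype.card_fin, nsmul_eq_mul] at hsum
  have e : vertexOfK K₂ N S μ y - vertexOfK K₂' N S' μ y = fun x z a b => ∑ κ : Fin (d + 1),
      (wsum (colH K₂ N μ y κ) (S κ) - wsum (colH K₂' N μ y κ) (S' κ)) x z a b := by
    funext x z a b
    simp only [vertexOfK, Pi.sub_apply, Finset.sum_sub_distrib]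
  rw [e]
  exact hsum

/-- [folklore] **THE MULTIPLIER-COLUMN VERTEX THROUGH A BI-LOCALISED KERNEL IS LIPSCHITZ IN (kernel, tables)** (coarse-localised multiplier tables
`VertexFamily M N CM m`): `BiLoc (vertexOfM K₂ N M μ y − vertexOfM K₂′ N M′ μ y) q q ((d+1)·((ε₂·CM + C₂′·εM)·Zl(m/2))) (m/2)`. -/
theorem biLoc_vertexOfM_of_biLoc_sub {K₂ K₂' : MKer (d + 1) (Fib d)} {q : Fin (d + 1) → ℤ} {C₂ C₂' ε₂ m : ℝ}
    (hK : BiLoc K₂ q q C₂ m) (hK' : BiLoc K₂' q q C₂' m) (hKK : BiLoc (K₂ - K₂') q q ε₂ m) (hm : 0 < m)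
    {M M' : Fin (d + 1) → (Fin (d + 1) → ℤ) → MKer (d + 1) (Fib d)} {CM CM' εM : ℝ}
    (hM : VertexFamily M N CM m) (hM' : VertexFamily M' N CM' m) (hMM : VertexFamily (M - M') N εM m) (μ : Fin (d + 1)) (y : Fin (d + 1) → ℤ) :
    BiLoc (vertexOfM K₂ N M μ y - vertexOfM K₂' N M' μ y) q q ((d + 1 : ℕ) * ((ε₂ * CM + C₂' * εM) * Zl (d + 1) (m / 2))) (m / 2) := by
  have hterm : ∀ ρ : Fin (d + 1), BiLoc (cwsum N (colM K₂ N μ y ρ) (M ρ) - cwsum N (colM K₂' N μ y ρ) (M' ρ)) q q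
      ((ε₂ * CM + C₂' * εM) * Zl (d + 1) (m / 2)) (m / 2) := fun ρ =>
    biLoc_cwsum_sub_self (fun w => abs_colM_le_of_biLoc' (N := N) hK hm.le μ y ρ w) (fun w => abs_colM_le_of_biLoc' (N := N) hK' hm.le μ y ρ w)
      (fun w => abs_colM_le_of_biLoc' (N := N) (K := K₂ - K₂') hKK hm.le μ y ρ w)
      (fun w => hM ρ w) (fun w => hM' ρ w) (fun w => by simpa only [Pi.sub_apply] using hMM ρ w) hm
  have hsum := biLoc_finset_sum (Finset.univ : Finset (Fin (d + 1))) (fun ρ _ => hterm ρ)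
  simp only [Finset.sum_const, Finset.card_univ, Fintype.card_fin, nsmul_eq_mul] at hsum
  have e : vertexOfM K₂ N M μ y - vertexOfM K₂' N M' μ y = fun x z a b => ∑ ρ : Fin (d + 1),
      (cwsum N (colM K₂ N μ y ρ) (M ρ) - cwsum N (colM K₂' N μ y ρ) (M' ρ)) x z a b := by
    funext x z a b
    simp only [vertexOfM, Pi.sub_apply, Finset.sum_sub_distrib]
  rw [e]
  exact hsum

end Through

/-! ## §2 The second-response piece is Lipschitz in `(K2, S, M)` -/

section Resp

/-- [folklore] **THE SECOND-RESPONSE PIECE IS LIPSCHITZ IN (the derivative-of-the-inverse slot, stencils, multiplier tables)**: for vertex families `K2, K2′`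
(`VertexFamily … N C₂ m`, difference `ε₂`), local stencils and coarse-localised multiplier tables with their differences (all at rate `m`), every `(μ, y, ν, y′)`:
`BiLoc (dM (K2 ν y′) N S M μ y − dM (K2′ ν y′) N S′ M′ μ y) (N•y′) (N•y′) ((d+1)·((ε₂·Cs + C₂′·εS)·Zl(m/2)) + (d+1)·((ε₂·CM + C₂′·εM)·Zl(m/2))) (m/2)`
(one centre; the uniform version is Literature `SecondOrderResponse.vertexFamily₂_resp`). -/
theorem biLoc_resp_sub {K2 K2' : Fin (d + 1) → (Fin (d + 1) → ℤ) → MKer (d + 1) (Fib d)} {C₂ C₂' ε₂ m : ℝ}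
    (hK2 : VertexFamily K2 N C₂ m) (hK2' : VertexFamily K2' N C₂' m) (hKK2 : VertexFamily (K2 - K2') N ε₂ m) (hm : 0 < m)
    {S S' : Fin (d + 1) → (Fin (d + 1) → ℤ) → MKer (d + 1) (Fib d)} {Cs Cs' εS : ℝ}
    (hS : LocStencil S Cs m) (hS' : LocStencil S' Cs' m) (hSS : LocStencil (S - S') εS m)
    {M M' : Fin (d + 1) → (Fin (d + 1) → ℤ) → MKer (d + 1) (Fib d)} {CM CM' εM : ℝ}
    (hM : VertexFamily M N CM m) (hM' : VertexFamily M' N CM' m) (hMM : VertexFamily (M - M') N εM m)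
    (μ : Fin (d + 1)) (y : Fin (d + 1) → ℤ) (ν : Fin (d + 1)) (y' : Fin (d + 1) → ℤ) :
    BiLoc (dM (K2 ν y') N S M μ y - dM (K2' ν y') N S' M' μ y) ((N : ℤ) • y') ((N : ℤ) • y')
      ((d + 1 : ℕ) * ((ε₂ * Cs + C₂' * εS) * Zl (d + 1) (m / 2)) + (d + 1 : ℕ) * ((ε₂ * CM + C₂' * εM) * Zl (d + 1) (m / 2))) (m / 2) := by
  have hKK2' : BiLoc (K2 ν y' - K2' ν y') ((N : ℤ) • y') ((N : ℤ) • y') ε₂ m := by simpa only [Pi.sub_apply] using hKK2 ν y'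
  have h1 := biLoc_vertexOfK_of_biLoc_sub (N := N) (hK2 ν y') (hK2' ν y') hKK2' hm hS hS' hSS μ y
  have h2 := biLoc_vertexOfM_of_biLoc_sub (N := N) (hK2 ν y') (hK2' ν y') hKK2' hm hM hM' hMM μ y
  have h := biLoc_add h1 h2
  have e : dM (K2 ν y') N S M μ y - dM (K2' ν y') N S' M' μ y =
      (vertexOfK (K2 ν y') N S μ y - vertexOfK (K2' ν y') N S' μ y) + (vertexOfM (K2 ν y') N M μ y - vertexOfM (K2' ν y') N M' μ y) := by
    funext x z a b
    simp only [dM, Pi.sub_apply, Pi.add_apply]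
    ring
  rw [e]
  exact h

end Resp

/-! ## §3 At `K2 := K2OfK K N S M`: the rate form and the constructed limit of the fourth summand of `W2OfK` -/

section K2Limit

variable {K : ℕ → MKer (d + 1) (Fib d)} {Kinf : MKer (d + 1) (Fib d)}
  {S : ℕ → Fin (d + 1) → (Fin (d + 1) → ℤ) → MKer (d + 1) (Fib d)} {Sinf : Fin (d + 1) → (Fin (d + 1) → ℤ) → MKer (d + 1) (Fib d)}
  {M : ℕ → Fin (d + 1) → (Fin (d + 1) → ℤ) → MKer (d + 1) (Fib d)} {Minf : Fin (d + 1) → (Fin (d + 1) → ℤ) → MKer (d + 1) (Fib d)}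
  {C cK Cs cS CM cM m θ : ℝ}

/-- [folklore] **`K2OfK` CONVERGES GEOMETRICALLY AS A VERTEX FAMILY** when `(K_j, S_j, M_j) → (K∞, S∞, M∞)` geometrically with uniform rows (rate `m` in, `m/8` out; the
constant is FILE 1's Lipschitz constant with `(εK, εS, εM) := (cK, cS, cM)·θ^j`, homogeneous of degree one). -/
theorem vertexFamily_K2OfK_rate (hK : ∀ j, Decays (K j) C m) (hKinf : Decays Kinf C m) (hKrate : ∀ j, Decays (K j - Kinf) (cK * θ ^ j) m)
    (hS : ∀ j, LocStencil (S j) Cs m) (hSinf : LocStencil Sinf Cs m) (hSrate : ∀ j, LocStencil (S j - Sinf) (cS * θ ^ j) m)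
    (hM : ∀ j, VertexFamily (M j) N CM m) (hMinf : VertexFamily Minf N CM m) (hMrate : ∀ j, VertexFamily (M j - Minf) N (cM * θ ^ j) m)
    (hm : 0 < m) (j : ℕ) :
    VertexFamily (K2OfK (K j) N (S j) (M j) - K2OfK Kinf N Sinf Minf) N
      (((Fintype.card (Fib d) : ℝ) * (((Fintype.card (Fib d) : ℝ) *
          (cK * ((d + 1 : ℕ) * (C * Cs * Zl (d + 1) (m / 2)) + (d + 1 : ℕ) * (C * CM * Zl (d + 1) (m / 2))) +
            C * ((d + 1 : ℕ) * ((cK * Cs + C * cS) * Zl (d + 1) (m / 2)) + (d + 1 : ℕ) * ((cK * CM + C * cM) * Zl (d + 1) (m / 2)))) *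
          Zl (d + 1) (m / 2 / 2)) * C +
        ((Fintype.card (Fib d) : ℝ) * (C * ((d + 1 : ℕ) * (C * Cs * Zl (d + 1) (m / 2)) + (d + 1 : ℕ) * (C * CM * Zl (d + 1) (m / 2)))) *
          Zl (d + 1) (m / 2 / 2)) * cK) * Zl (d + 1) (m / 2 / 4)) * θ ^ j) (m / 2 / 4) := by
  have h := vertexFamily_K2OfK_sub (N := N) (hK j) hKinf (hKrate j) hm (hS j) hSinf (hSrate j) (hM j) hMinf (hMrate j)
  intro ν y' x z a b
  refine (h ν y' x z a b).trans (le_of_eq ?_)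
  ring

/-- [folklore] **THE FOURTH SUMMAND CONVERGES GEOMETRICALLY**, entry family by entry family, one-centre at `(N•y′, N•y′)` (rate `m/16` out). -/
theorem biLoc_resp_K2OfK_rate (hK : ∀ j, Decays (K j) C m) (hKinf : Decays Kinf C m) (hKrate : ∀ j, Decays (K j - Kinf) (cK * θ ^ j) m)
    (hS : ∀ j, LocStencil (S j) Cs m) (hSinf : LocStencil Sinf Cs m) (hSrate : ∀ j, LocStencil (S j - Sinf) (cS * θ ^ j) m)
    (hM : ∀ j, VertexFamily (M j) N CM m) (hMinf : VertexFamily Minf N CM m) (hMrate : ∀ j, VertexFamily (M j - Minf) N (cM * θ ^ j) m)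
    (hm : 0 < m) (μ : Fin (d + 1)) (y : Fin (d + 1) → ℤ) (ν : Fin (d + 1)) (y' : Fin (d + 1) → ℤ) :
    ∃ c : ℝ, ∀ j : ℕ, BiLoc (dM (K2OfK (K j) N (S j) (M j) ν y') N (S j) (M j) μ y - dM (K2OfK Kinf N Sinf Minf ν y') N Sinf Minf μ y)
      ((N : ℤ) • y') ((N : ℤ) • y') (c * θ ^ j) (m / 2 / 4 / 2) := by
  have hC : 0 ≤ C := hKinf.nonneg (Sum.inl 0)
  have hCs : 0 ≤ Cs := (hSinf 0 0).nonneg (Sum.inl 0)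
  have hCM : 0 ≤ CM := (hMinf 0 0).nonneg (Sum.inl 0)
  -- the `K2OfK` slot: uniform rows (Literature `vertexFamily_K2OfK`) and the geometric rate (this file)
  have hK2 : ∀ j, VertexFamily (K2OfK (K j) N (S j) (M j)) N (cK2 d C Cs CM m) (m / 8) := fun j =>
    vertexFamily_K2OfK (hK j) hC hm (hS j) (hM j)
  have hK2inf : VertexFamily (K2OfK Kinf N Sinf Minf) N (cK2 d C Cs CM m) (m / 8) := vertexFamily_K2OfK hKinf hC hm hSinf hMinf
  have hrate := vertexFamily_K2OfK_rate (N := N) hK hKinf hKrate hS hSinf hSrate hM hMinf hMrate hm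
  set A : ℝ := ((Fintype.card (Fib d) : ℝ) * (((Fintype.card (Fib d) : ℝ) *
          (cK * ((d + 1 : ℕ) * (C * Cs * Zl (d + 1) (m / 2)) + (d + 1 : ℕ) * (C * CM * Zl (d + 1) (m / 2))) +
            C * ((d + 1 : ℕ) * ((cK * Cs + C * cS) * Zl (d + 1) (m / 2)) + (d + 1 : ℕ) * ((cK * CM + C * cM) * Zl (d + 1) (m / 2)))) *
          Zl (d + 1) (m / 2 / 2)) * C +
        ((Fintype.card (Fib d) : ℝ) * (C * ((d + 1 : ℕ) * (C * Cs * Zl (d + 1) (m / 2)) + (d + 1 : ℕ) * (C * CM * Zl (d + 1) (m / 2)))) *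
          Zl (d + 1) (m / 2 / 2)) * cK) * Zl (d + 1) (m / 2 / 4)) with hA
  have e8 : m / 2 / 4 = m / 8 := by ring
  -- the tables at the slot's rate `m/8`
  have hS8 : ∀ j, LocStencil (S j) Cs (m / 8) := fun j κ u => biLoc_mono (hS j κ u) hCs (by linarith)
  have hSinf8 : LocStencil Sinf Cs (m / 8) := fun κ u => biLoc_mono (hSinf κ u) hCs (by linarith)
  have hSrate8 : ∀ j, LocStencil (S j - Sinf) (cS * θ ^ j) (m / 8) := fun j κ u =>
    biLoc_mono (hSrate j κ u) ((hSrate j κ u).nonneg (Sum.inl 0)) (by linarith)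
  have hM8 : ∀ j, VertexFamily (M j) N CM (m / 8) := fun j ρ w => biLoc_mono (hM j ρ w) hCM (by linarith)
  have hMinf8 : VertexFamily Minf N CM (m / 8) := fun ρ w => biLoc_mono (hMinf ρ w) hCM (by linarith)
  have hMrate8 : ∀ j, VertexFamily (M j - Minf) N (cM * θ ^ j) (m / 8) := fun j ρ w =>
    biLoc_mono (hMrate j ρ w) ((hMrate j ρ w).nonneg (Sum.inl 0)) (by linarith)
  refine ⟨(d + 1 : ℕ) * ((A * Cs + cK2 d C Cs CM m * cS) * Zl (d + 1) (m / 8 / 2)) +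
      (d + 1 : ℕ) * ((A * CM + cK2 d C Cs CM m * cM) * Zl (d + 1) (m / 8 / 2)), fun j => ?_⟩
  have hr : VertexFamily (K2OfK (K j) N (S j) (M j) - K2OfK Kinf N Sinf Minf) N (A * θ ^ j) (m / 8) := by
    rw [← e8]; exact hrate j
  have h := biLoc_resp_sub (N := N) (hK2 j) hK2inf hr (by positivity) (hS8 j) hSinf8 (hSrate8 j) (hM8 j) hMinf8 (hMrate8 j) μ y ν y'
  have e16 : m / 2 / 4 / 2 = m / 8 / 2 := by ring
  rw [e16]
  intro x z a b
  refine (h x z a b).trans (le_of_eq ?_)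
  ring

/-- [folklore] **THE CONSTRUCTED LIMIT OF THE FOURTH SUMMAND OF `W2OfK` IS THE SECOND-RESPONSE PIECE OF THE LIMITS**: under uniform rows + geometric rates of
`(K_j, S_j, M_j)` to `(K∞, S∞, M∞)` and `0 ≤ θ < 1`,
`limTabOf (j ↦ (μ y ν y′ ↦ dM (K2OfK (K j) N (S j) (M j) ν y′) N (S j) (M j) μ y)) = (μ y ν y′ ↦ dM (K2OfK K∞ N S∞ M∞ ν y′) N S∞ M∞ μ y)`. -/
theorem limTabOf_resp_eq (hK : ∀ j, Decays (K j) C m) (hKinf : Decays Kinf C m) (hKrate : ∀ j, Decays (K j - Kinf) (cK * θ ^ j) m)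
    (hS : ∀ j, LocStencil (S j) Cs m) (hSinf : LocStencil Sinf Cs m) (hSrate : ∀ j, LocStencil (S j - Sinf) (cS * θ ^ j) m)
    (hM : ∀ j, VertexFamily (M j) N CM m) (hMinf : VertexFamily Minf N CM m) (hMrate : ∀ j, VertexFamily (M j - Minf) N (cM * θ ^ j) m)
    (hm : 0 < m) (hθ0 : 0 ≤ θ) (hθ1 : θ < 1) :
    limTabOf (fun j μ y ν y' => dM (K2OfK (K j) N (S j) (M j) ν y') N (S j) (M j) μ y) =
      fun μ y ν y' => dM (K2OfK Kinf N Sinf Minf ν y') N Sinf Minf μ y :=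
  funext fun μ => funext fun y => funext fun ν => funext fun y' => by
    obtain ⟨c, hc⟩ := biLoc_resp_K2OfK_rate (N := N) hK hKinf hKrate hS hSinf hSrate hM hMinf hMrate hm μ y ν y'
    exact limMKerOf_eq_of_biLoc_rate (T := fun j => dM (K2OfK (K j) N (S j) (M j) ν y') N (S j) (M j) μ y) hc hθ0 hθ1

/-- [folklore] … and the entrywise convergence itself (for `BiVertexLimit.limTabOf_add_of_tendsto`). -/
theorem tendsto_resp (hK : ∀ j, Decays (K j) C m) (hKinf : Decays Kinf C m) (hKrate : ∀ j, Decays (K j - Kinf) (cK * θ ^ j) m)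
    (hS : ∀ j, LocStencil (S j) Cs m) (hSinf : LocStencil Sinf Cs m) (hSrate : ∀ j, LocStencil (S j - Sinf) (cS * θ ^ j) m)
    (hM : ∀ j, VertexFamily (M j) N CM m) (hMinf : VertexFamily Minf N CM m) (hMrate : ∀ j, VertexFamily (M j - Minf) N (cM * θ ^ j) m)
    (hm : 0 < m) (hθ0 : 0 ≤ θ) (hθ1 : θ < 1) (μ : Fin (d + 1)) (y : Fin (d + 1) → ℤ) (ν : Fin (d + 1)) (y' : Fin (d + 1) → ℤ)
    (x z : Fin (d + 1) → ℤ) (a b : Fib d) :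
    Tendsto (fun j => dM (K2OfK (K j) N (S j) (M j) ν y') N (S j) (M j) μ y x z a b) atTop
      (𝓝 (dM (K2OfK Kinf N Sinf Minf ν y') N Sinf Minf μ y x z a b)) := by
  obtain ⟨c, hc⟩ := biLoc_resp_K2OfK_rate (N := N) hK hKinf hKrate hS hSinf hSrate hM hMinf hMrate hm μ y ν y'
  exact tendsto_of_biLoc_rate (T := fun j => dM (K2OfK (K j) N (S j) (M j) ν y') N (S j) (M j) μ y) hc hθ0 hθ1 x z a b

end K2Limit

end Summit.QuantumFields.BalabanUV.Beta.FP.ResponseVertexLimit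

end
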